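import Summits.QuantumFields.YangMills.Theorems.BalabanUVNodesN12Prop1DirectOfClassOnlyRowL1NearRadiusDatumScaleAtLengthWindowUniform
import Literature.MathematicalPhysics.QuantumFieldTheory.Balaban1983to89.Node00.MultiScaleFibreChartB
import Literature.MathematicalPhysics.QuantumFieldTheory.Balaban1983to89.B15Sect1InstancesB
import Literature.MathematicalPhysics.QuantumFieldTheory.Balaban1983to89.Node00.LargeFieldBackgroundCoPOfRecordB
import Literature.MathematicalPhysics.QuantumFieldTheory.Balaban1983to89.B15Prop1PlaquetteLettersOfClassB
import Summits.QuantumFields.YangMills.Theorems.BalabanUVNodesN12Prop1DirectOfClassOnlyRowL1NearRadiusDatumScaleAtLengthB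
import Summits.QuantumFields.YangMills.Theorems.BalabanUVNodesN12WindowGaugeLetterUniformSocketLam
import HarnessLib

/-!
# BalabanUVNodes ∕ N12 — (E1)⁸ᴸ `(x)_direct` WITH THE k-UNIFORM WINDOW-LOCAL PRODUCER, AT THE DATUM SCALE, [15] THEOREM 1 (8) READ AT EACH INSTANCE's OWN LENGTH `k i` — **BOND-DATUM EDITION** (`…N12Prop1DirectOfClassOnlyRowL1NearRadiusDatumScaleAtLengthWindowUniformB`, USED DECLARATIONS ONLY)

The print-datum ([Balaban1984PropagatorsII] (2.3)) (γ) twin of `Summits/…/Theorems/BalabanUVNodesN12Prop1DirectOfClassOnlyRowL1NearRadiusDatumScaleAtLengthWindowUniform.lean`: the declarations of the parent whose STATEMENT reads the determining datum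
(`exists_domain_prop1Printed_lfVarOn_std_su2_box_intrinsic_analytic_atZSeqCoPRecord_ofThm1AtLength_ofMinimiserFamily_ofClassOnlyRowL1NearRadiusDatumScale_ofWindowGaugeUniform_explicit`) and which N12's junction of record v14ᴸ uses (dag-n12-c g35 probe-2 census `UsedConstsN12RoadTyped2`, THEOREMS block), re-typed over a
BOND-LEVEL datum `𝔅 : BDetSet` (F0a `B15DeterminingSetsB`) and dag-n12-c's bond-datum chart `Node00.msChartB` (✓p774329; `msChart 𝐁 = msChartB (bondsDet 𝐁)` by `rfl`).  GENERATOR twin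
(this seat's `work/g32/gen_thm.py`, block-extracted from the parent's tree bytes): namespace `…N12Prop1DirectOfClassOnlyRowL1NearRadiusDatumScaleAtLengthWindowUniformB`, SAME short names, `DetSet ↦ BDetSet`, `AgreeOn 𝐁 ↦ AgreeOnB 𝔅`,
`IsMinimizer ↦ IsMinimizerB`, `bondsOf (𝐁 j) ↦ 𝔅 j`, `msChart ∕ constrCard ∕ constrEnum ∕ ConstrSet ↦ …B`, NODE 00 chart lemmas `…msChart… ↦ …msChartB…`; proofs VERBATIM; the parent's
datum-free declarations REUSED BY NAME (`open`), never copied (private plumbing excepted, №366 R2).  The parent's (b) statements are the instances `𝔅 := bondsDet 𝐁`.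
L4ᴮ — the parent (L2 + (σ)_W ∕ plaquette ∕ tower-box letters FROM THE CLASS) AT PRINT`s [II] (2.3) DATUM: statement surgery exactly as L2ᴮ ✓p781501 (`Bj ν.M₁ (Z i) (k i) ↦ lamBondsSeq (maxDomT ν.M₁ (Z i)) (k i)`, `h15T` over `lamBondsSeq s.Ω (k i)`, `hhalf` with the `S₀` letter, `√(Nat.card ·)` on the TOUCHING bonds, carrier `… ν.M₁ lamDatumP`, `hHrow` in the currency of w6`s ✓p775374); proof = the parent`s, the one call re-pointed at L2ᴮ and the three class producers at their print editions: dag-n12-c`s ✓`…WindowGaugeLetterUniformSocketLam.hσW_uniform_of_plaqSmall_lamBondsSeq` ((σ)_W: `IsMinimizerB … (lamBondsSeq …)`, root letter on print`s bonds), Lit `B15Prop1PlaquetteLettersOfClassB.norm_plaqHol_sub_one_le_of_isMinimizer_of_cornerBond_touching` (the plaquette letter on the plaquettes meeting the TOUCHING set — a plaquette with a bond ending in `Ω₁(Z)` lies inside the class`s small-plaquette region) and `….plaqSmallOn_towerBox_of_isMinimizer` (B).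
Cell `pub-ymgap` (HUMAN RULINGS D-0062 ∕ D-0149), seat `pub-ymgap-dag-n12-d` g32 (R134 N12 [B15] s2; the (ii) Theorems-side re-key of N12's road at print's [II] (2.3) datum — director-ym №338 ∕
№343 (E1)(iii-b), FLAG №16 ∕ ruling (α); dag-n12-c DESIGN memo a793b2ebc0b803bf (ii); `N12-ROAD-TWIN-ORDER-2026-08-30.md`).  Count-neutral helper of K1⁹ `stmt-QuantumFields-27364`,
`--kind proof --supports … --as helper`.  THEOREMS ONLY (0 `def`, 0 `instance`, 0 `sorry`).

HONEST FRAMING (director-ym №338 (5)).  PURELY ADDITIVE: the parent stays landed and true on its own text; nothing in it is edited; no displayed premise of any consumer is deleted or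
weakened; every hypothesis of the parent stays a hypothesis.  Nothing of Bałaban's analysis asserted; N12 NOT discharged; K0⁷ ∕ K1⁹ NOT closed; counts unmoved (typed 28∕28 · discharged
8∕27, A 8∕28; K 1∕4); one finite 𝕋⁴ programme at fixed ε — R4 closes the conditional rung `BalabanLadder.UV` only; NOT the Yang–Mills mass gap (Clay); nothing continuum ∕ ℝ⁴ ∕ OS.

PARENT's DOCSTRING (the mathematics and the citations; read the site-level `𝐁` as the bond datum `𝔅`):
(see the parent module — not reproduced here, 400-line lint; the citations of every declaration below are carried in its own docstring)
-/

noncomputable section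

open Set Finset Metric Filter
open scoped BigOperators Matrix RealInnerProductSpace Real InnerProductSpace Topology Matrix.Norms.L2Operator

namespace Summit.QuantumFields.YangMills.BalabanUVNodes.N12Prop1DirectOfClassOnlyRowL1NearRadiusDatumScaleAtLengthWindowUniformB

open Literature.MathematicalPhysics.QuantumFieldTheory.Balaban1983to89.B15DeterminingSetsB

open Literature.MathematicalPhysics.QuantumFieldTheory.Balaban1983to89
open T4Continuum B15DeterminingSets GaugeField B16Sect1Backgrounds B15Prop1Carrier B8Eq17ClassAkV1 BlockAveraging
open B15Prop1SliceTaylorCalculus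
open B15Prop1ChartCalculusSU2 (E3)
open T4CubeChartGnomonic (SU2)
open B15Prop1ChartSU2 (su2Chart)
open B15Prop1SliceCoordinates (GaugeSlice ιA freeBonds)
open B15Prop1AnalyticExtClause (cplxVec anExt)
open T4AdjointCovarianceUnitary (lieSU)
open T4AxialGaugeSmallField (castSite boxPlaqs boxBonds)
open B6BondElimination (unitVec)
open B6TreeGaugePoincare (curl)
open B16Eq18Proof (box mem_box)
open B15Extension193 (extend)
open B15ShellGauge193 (shellGauge)
open B14.Eq213MaximalDomains (side)
open B14.Eq213DetSet B14.Eq216Concrete B15Sect1Instances B15Eq177GaugeInvariance B15Eq177ValueInvariance B15Eq177ValueInvarianceCoDiv B16Sect1Wilson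
open B14.Eq22Determines (blockIter IsBlockUnion)
open Literature.MathematicalPhysics.QuantumFieldTheory.BalabanImbrieJaffe1984to88.BIJ85Eq453GaugeField
open Node00 (expChart msChartB constrCardB constrCard)
open B15Eq112TorusCover (lift)
open B5Eq118OneStroke (iterBlockOf)
open ExpMeanLog (deltaSU)
open Summit.QuantumFields.YangMills.BalabanUVNodes.N12Prop1DirectOfClassOnlyRowL1NearRadiusDatumScaleAtLengthB (exists_domain_prop1Printed_lfVarOn_std_su2_box_intrinsic_analytic_atZSeqCoPRecord_ofThm1AtLength_ofMinimiserFamily_ofWindowGaugeLetter_ofClassOnlyRowL1NearRadiusDatumScale_explicit)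
open Summit.QuantumFields.YangMills.BalabanUVNodes.N12WindowGaugeLetterUniformSocketLam (hσW_uniform_of_plaqSmall_lamBondsSeq)
open B15Prop1PlaquetteLettersOfClassB (norm_plaqHol_sub_one_le_of_isMinimizer_of_cornerBond plaqSmallOn_towerBox_of_isMinimizer)
open Node00 (avOfRecord regMSCoPOfRecord coeField constrEnumB constrEnum)
open B15Prop1PlaquetteLettersOfClassB (norm_plaqHol_sub_one_le_of_isMinimizer_of_cornerBond_touching)

section
variable {F : T4Family}

/-- **PRINT-DATUM EDITION** — the statement at [II] (2.3)'s datum `lamBondsSeq (maxDomT ν.M₁ (Z i)) (k i)` (`= lamDatumP (k i) (maxDomT ν.M₁ (Z i))`, `rfl`); (σ)_W, the plaquette letter (at the TOUCHING set) and the tower-box letter DISCHARGED from the class by dag-n12-c's `…WindowGaugeLetterUniformSocketLam.hσW_uniform_of_plaqSmall_lamBondsSeq` ∕ `B15Prop1PlaquetteLettersOfClassB`; proof = the parent's over L2ᴮ ✓p781501 — see the module docstring. **AT-LENGTH EDITION** of T3′ ✓p747250 ([15] letter `h15T` at the length `k i` of each instance; the call re-pointed at (D1)⁶ᴸ; everything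 else as in the file it twins) — **DATUM-SCALE EDITION** (lane ruling (B) «(8)-FLOOR»: class-reading letters at `ν″ := ν⟨εreg := 2·B₃·(cE+1)·eR⟩`, floors at the data budget, `heRa` doubled, conversion letters `hKa`∕`hKb` displayed; everything else as in the file it twins) — ★★★ **(E1)⁸ `(x)_direct` — NO LETTER ABOUT THE MINIMISER UNDER THE THRESHOLD, (μ) ROW IN PER-ROW ℓ¹ CURRENCY, BOOKKEEPING ROWS IN THE NEAR CURRENCY (census U3): (D1)⁶ with the window gauge
letter (σ)_W, the plaquette letter `hPχ` AND the tower-box plaquette letter `hPbox` all DISCHARGED BY NAME from the (2.12) class of the minimiser** (dag-n12-w6 g7's k-UNIFORM window-LOCAL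
producer `hσW_on_uniform_of_class_lamBondsSeq` p675589; dag-n12-c g21's `hPχ_on_of_class` ∕ `hPbox_on_of_class` p675521).  Statement = (E1)⁶'s (p688381) VERBATIM with the two bookkeeping rows re-typed against
the near plaquette count `#S_i := Nat.card {q : Plaq(T_η) ∕∕ q ∈ plaqsOf Ω₁(Z_i)}`: `hcA : ∀ i, ½(B₃(c_E+1)η₁²)²·#S_i ≤ cA`, `hcJ' : ∀ i, 2cA·eR i∕R i + 2·(#S_i·(1+8(𝓐₀ i)⁴))∕(R i·eR i) ≤ cJ`; the
k-uniform producer's rows, the EXPLICIT-threshold frame `∀ δ, 0 < δ ≤ min Θ εH` with the k-free floor `hfloor`, the clause's radius (total bound) UNCHANGED.  Proof: (E1)⁶'s verbatim — one call of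
(D1)⁶ with `hσW := hσW_on_uniform_of_class_lamBondsSeq … hfloor hfloor`, `hPχ := hPχ_on_of_class …`, `hPbox := hPbox_on_of_class …`.
[cite: Balaban1989LargeFieldI, (1.74) p.192, (1.77) and Prop. 1 (1.77)–(1.78) p.194, (1.79) p.195; Balaban1989LargeFieldII, (1.2)–(1.6) p.357, (1.7)–(1.9) p.358, (1.11)–(1.13) pp.358–359; Balaban1985Variational, (2)–(4) p.278, Thm 1 (8) p.279, (16)–(18) p.280, (44)–(48) p.285, (83) p.290; Balaban1985Averaging, (5) p.18, Prop. 2 (52)–(53) p.26; Balaban1988Convergent, (2.2) p.255, (2.10)–(2.14) pp.256–257, (2.16) p.257] -/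
theorem exists_domain_prop1Printed_lfVarOn_std_su2_box_intrinsic_analytic_atZSeqCoPRecord_ofThm1AtLength_ofMinimiserFamily_ofClassOnlyRowL1NearRadiusDatumScale_ofWindowGaugeUniform_explicit
    (ν : Node00.Stage7Numerics) (Kt : ℕ) (hd3 : 3 ≤ (F.P Kt).d) (h0 : 0 < (F.P Kt).d) {ι : Type}
    (Z Λ : ι → Set (Site (F.P Kt) 0)) (k : ι → ℕ) (M : ι → ℝ) (hk0 : ∀ i, 0 < k i) (hk1 : ∀ i, k i + 1 ≤ (F.P Kt).m + (F.P Kt).K)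
    (eR : ι → ℝ) (heR : ∀ i, 0 < eR i)
    (T : ∀ i, Finset (PBond (F.P Kt) (k i)))
    (lo hi : ι → Fin (F.P Kt).d → ℤ) (n : ι → ℕ) (hn : ∀ i κ, hi i κ ≤ lo i κ + n i) (hN : ∀ i, n i + 2 < (F.P Kt).sitesPerDir (k i))
    (hbox : ∀ i, pts (k i) (Λ i) = (castSite '' Set.Icc (lo i) (hi i) : Set (Site (F.P Kt) (k i))))
    (hZ : ∀ i, (boxPlaqs (lo i - 1) (hi i + 1) : Set (Plaq (F.P Kt) (k i))) ⊆ plaqsInside (pts (k i) (Z i)))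
    (hTG0 : ∀ i, T i = (box (fun κ => (hi i κ - lo i κ + 1).toNat) (lo i)).image fun x =>
      (⟨castSite (x - unitVec ⟨0, h0⟩), ⟨0, h0⟩⟩ : PBond (F.P Kt) (k i)))
    (hN5 : ∀ i κ, ((hi i κ - lo i κ + 1).toNat : ℤ) + 5 < (F.P Kt).sitesPerDir (k i))
    (K : ι → ℕ) (hK1 : ∀ i, 1 ≤ K i) (hKn : ∀ i κ, (hi i κ - lo i κ + 1).toNat ≤ K i)
    (ext : ∀ i, GaugeField (F.P Kt) (k i) SU2 → GaugeField (F.P Kt) (k i) SU2)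
    (hext : ∀ i Vk, ext i Vk = extend (pts (k i) (Λ i)) (shellGauge Vk (lo i) (hi i)) Vk)
    (hlohi : ∀ i, lo i ≤ hi i)
    -- the REGION parallelepipeds of the normalisation and the datum tolerances
    (LO HI : ι → Fin (F.P Kt).d → ℤ) (hLO : ∀ i, LO i ≤ lo i - 1) (hHI : ∀ i, hi i + 1 ≤ HI i) (n' : ι → ℕ) (hn' : ∀ i κ, HI i κ ≤ LO i κ + n' i)
    (hn'N : ∀ i, n' i < (F.P Kt).sitesPerDir (k i)) (hR' : ∀ i, (boxPlaqs (LO i) (HI i) : Set (Plaq (F.P Kt) (k i))) ⊆ plaqsInside (pts (k i) (Z i)))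
    (ρn : ι → ℝ)
    (hρn : ∀ i, (((F.P Kt).d : ℝ) * n' i + 1) * ((((F.P Kt).d - 1 : ℕ) : ℝ) * n' i * ((12 * (F.P Kt).d * (n i + 2) ^ 2 + 1) * eR i)
      + 3 * (F.P Kt).d * (n i + 2) ^ 2 * eR i) ≤ ρn i)
    {γ cJ bx : ℝ} (hγ : 0 < γ) (hcJ : 0 ≤ cJ) (hbx : 0 ≤ bx)
    (hbxM : ∀ i, 12 * ((F.P Kt).d : ℝ) * ((n i : ℝ) + 2) ^ 2 ≤ bx * (M i) ^ 2)
    {R 𝓐₀ : ι → ℝ} (hM : ∀ i, 1 ≤ (M i)) (hR : ∀ i, 0 < R i) (h𝓐₀ : ∀ i, 0 ≤ 𝓐₀ i)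
    -- (J0′), R-EXPLICIT: per instance one radius and one bound for every base field of the strict guard
    (hMin : ∀ i Vk, PlaqSmallOn (plaqsInside (pts (k i) (Z i ∩ (Λ i)ᶜ))) (eR i) Vk →
      ∃ Ũ : VecField (F.P Kt) (k i) (EuclideanSpace ℂ (Fin 3)) × VecField (F.P Kt) (k i) (EuclideanSpace ℂ (Fin 3)) →
          PBond (F.P Kt) 0 → Matrix (Fin 2) (Fin 2) ℂ,
        (∀ b a c, DifferentiableOn ℂ (fun z => Ũ z b a c) (ball 0 (R i))) ∧
        (∀ z ∈ ball (0 : VecField (F.P Kt) (k i) (EuclideanSpace ℂ (Fin 3)) × VecField (F.P Kt) (k i) (EuclideanSpace ℂ (Fin 3))) (R i),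
          ∀ b a c, ‖Ũ z b a c‖ ≤ 𝓐₀ i) ∧
        ∀ p B' : VecField (F.P Kt) (k i) E3, ‖p‖ < R i → ‖B'‖ < R i → ∃ U' : GaugeField (F.P Kt) 0 SU2,
          (∀ b, Ũ (cplxVec p, cplxVec B') b = ((U' b : SU2) : Matrix (Fin 2) (Fin 2) ℂ)) ∧
            IsMinimizerB (Node00.avOfRecord F 2 Kt) (Node00.regMSCoPOfRecord F 2 ν Kt (k i) (maxDomT ν.M₁ (Z i))) (lamBondsSeq (maxDomT ν.M₁ (Z i)) (k i))
              (avgFamily (Node00.avOfRecord F 2 Kt) (qsstarGIter0 (k i) (expMul su2Chart B' (ext i (expMul su2Chart p Vk))))) U')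
    -- dag-n12-w4's GEOMETRY letter of the chart file (the window box and its two shifts inside `Ω_k(Z)`)
    (hΩw : ∀ i, ∀ (ν' : Fin (F.P Kt).d), ∀ z ∈ box (fun κ => (hi i κ - lo i κ + 1).toNat + 3) (fun κ => lo i κ - 2),
      (castSite z : Site (F.P Kt) (k i)) ∈ pts (k i) (maxDomT ν.M₁ (Z i) (k i)) ∧
        (castSite z : Site (F.P Kt) (k i)).shift ⟨0, h0⟩ ∈ pts (k i) (maxDomT ν.M₁ (Z i) (k i)) ∧
        (castSite z : Site (F.P Kt) (k i)).shift ν' ∈ pts (k i) (maxDomT ν.M₁ (Z i) (k i)))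
    -- the WINDOW per instance, containing every plaquette whose source lies in the fine image of the enlarged window box (the chart half's `hW`)
    (W : ι → Finset (Plaq (F.P Kt) 0))
    (hWbox : ∀ i, ∀ q : Plaq (F.P Kt) 0, q.src ∈ ((box (fun κ => (F.P Kt).L ^ (k i) * ((hi i κ - lo i κ + 1).toNat + 3 + 1) - 1) (fun κ => ((F.P Kt).L : ℤ) ^ (k i) * (lo i κ - 2))).image
        (fun z => (castSite z : Site (F.P Kt) 0))) → q ∈ W i)
    -- dag-n12-w6 g7's k-UNIFORM WINDOW-LOCAL (σ)_W producer `N12WindowGaugeLetterUniformSocketLam.hσW_on_uniform_of_class_lamBondsSeq` (general `Z`, no letter off the window, tolerance `C(d,L)·εreg + m′·ρn`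
    -- INDEPENDENT of `k`): its NUMERICS per instance (level guard `k + c ≤ m + K` with `4d + m′ + 3 < 2L^c`), the class threshold `εreg` positive and Prop. 2-small, the WINDOW `X i` within
    -- walk-distance `D₀ i` of `Ω_{k_i}(Z_i)` (`hXΩ`) with the collar fit `hfit`, the REGION-BOX ROW `hBox` and the two window rows `hWX hfeedsX`
    (c : ι → ℕ) (hkc : ∀ i, k i + c i ≤ (F.P Kt).m + (F.P Kt).K) (hc : ∀ i, 4 * (F.P Kt).d + (3 * ((F.P Kt).d * (((F.P Kt).L - 1) / 2)) + 5) + 3 < 2 * (F.P Kt).L ^ c i)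
    (hα3 : (143 * (((((F.P Kt).d + 4 : ℕ) : ℝ)) ^ 2 / 4) ^ 2) * (ν.εreg * (F.P Kt).L ^ 2) ≤ 1 / 3)
    (hα2 : 2 * (ν.εreg * (F.P Kt).L ^ 2) ≤ 2 * deltaSU (Fin 2) / ((((F.P Kt).d + 4) * (F.P Kt).L : ℕ) : ℝ) ^ 2)
    (haN : (((((F.P Kt).d + 2) * (F.P Kt).L : ℕ) : ℝ) ^ 2 / 4) * (2 * (ν.εreg * (F.P Kt).L ^ 2)) < deltaSU (Fin 2))
    (X : ι → Set (Site (F.P Kt) 0)) (D₀ : ι → ℕ)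
    (hXΩ : ∀ i, ∀ x ∈ X i, ∃ x₀ ∈ maxDomT ν.M₁ (Z i) (k i), ∃ w₀ : List (Letter (F.P Kt).d), w₀.length ≤ D₀ i ∧ walkEnd x₀ w₀ = x)
    (hfit : ∀ i, D₀ i + 3 * (∑ i' ∈ Finset.range (k i + 1), ((F.P Kt).d * (((F.P Kt).L ^ i' - 1) / 2) + 1)) + ((3 * ((F.P Kt).d * (((F.P Kt).L - 1) / 2)) + 5) + 5) * (F.P Kt).L ^ k i +
      (((F.P Kt).d + 4) * (F.P Kt).L + 2) * (∑ l ∈ Finset.Ico 0 (k i), (F.P Kt).L ^ l) + 4 ≤ (F.P Kt).L ^ (k i - 1) * ν.M₁)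
    (hBox : ∀ i, ∀ x ∈ X i, ∀ w : List (Letter (F.P Kt).d),
      w.length ≤ (∑ i' ∈ Finset.range (k i + 1), ((F.P Kt).d * (((F.P Kt).L ^ i' - 1) / 2) + 1)) + (3 * ((F.P Kt).d * (((F.P Kt).L - 1) / 2)) + 5) * (F.P Kt).L ^ k i + (F.P Kt).L ^ k i →
      ∀ μ : Fin (F.P Kt).d, (⟨blockIter (k i) (walkEnd x w), μ⟩ : PBond (F.P Kt) (k i)) ∈ (boxBonds (LO i) (HI i) : Set (PBond (F.P Kt) (k i))))
    (hWX : ∀ i, ∀ p ∈ W i, p.src ∈ X i ∧ p.src.shift p.μ ∈ X i ∧ p.src.shift p.ν ∈ X i ∧ (p.src.shift p.μ).shift p.ν ∈ X i ∧ (p.src.shift p.ν).shift p.μ ∈ X i)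
    (hfeedsX : ∀ i (ν' : Fin (F.P Kt).d), ∀ z ∈ box (fun κ => (hi i κ - lo i κ + 1).toNat + 3) (fun κ => lo i κ - 2), ∀ b₀ : PBond (F.P Kt) 0,
      (b₀ ∈ feeds (k i) (⟨(castSite z : Site (F.P Kt) (k i)), ⟨0, h0⟩⟩ : PBond (F.P Kt) (k i)) ∨
        b₀ ∈ feeds (k i) (⟨((castSite z : Site (F.P Kt) (k i))).shift ⟨0, h0⟩, ν'⟩ : PBond (F.P Kt) (k i)) ∨
        b₀ ∈ feeds (k i) (⟨((castSite z : Site (F.P Kt) (k i))).shift ν', ⟨0, h0⟩⟩ : PBond (F.P Kt) (k i)) ∨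
        b₀ ∈ feeds (k i) (⟨(castSite z : Site (F.P Kt) (k i)), ν'⟩ : PBond (F.P Kt) (k i))) → b₀.src ∈ X i ∧ b₀.tgt ∈ X i)
    -- THE CHART HALF, DISPLAYED, `hsb`-FREE AND IN PER-ROW ℓ¹ CURRENCY (LOCATED-FLOOR + LOCATED-HSB + census U2b): FIVE per-height constants as BINDERS and ONE letter = the ∀-body of
    -- dag-n12-c g22's ρ6b `N12DirectChartPackageOfClassRowL1FamilyB.exists_hWD_chartHalf_of_class_uniform_rowl1_family` at height `k i` (the right inverse `H` witnesses surjectivity only;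
    -- its size enters through the PER-ROW ℓ¹ PREIMAGE LETTER at `B₁`, the curvature through the ℓ¹-curvature letter at `M₂`; (μ) constant `2(d−1)·εP·B₁·M₂` — NO torus bond count)
    (C ρ Kτ ρτ ρ5 : ι → ℝ) (hρ : ∀ i, 0 < ρ i) (hKτ : ∀ i, 0 ≤ Kτ i) (hρτ : ∀ i, 0 < ρτ i)
    (hhalf : ∀ i,
        ∀ (ν : Node00.Stage7Numerics) (Z Λ : Set (Site (F.P Kt) 0)) (T : Finset (PBond (F.P Kt) (k i))) (lo hi : Fin (F.P Kt).d → ℤ),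
        (∀ κ, ((((hi κ - lo κ + 1).toNat + 3 : ℕ) : ℤ)) ≤ (F.P Kt).sitesPerDir (k i)) →
        (∀ (ν' : Fin (F.P Kt).d), ∀ z ∈ box (fun κ => (hi κ - lo κ + 1).toNat + 3) (fun κ => lo κ - 2),
          (castSite z : Site (F.P Kt) (k i)) ∈ pts (k i) (maxDomT ν.M₁ Z (k i)) ∧ (castSite z : Site (F.P Kt) (k i)).shift ⟨0, h0⟩ ∈ pts (k i) (maxDomT ν.M₁ Z (k i)) ∧
            (castSite z : Site (F.P Kt) (k i)).shift ν' ∈ pts (k i) (maxDomT ν.M₁ Z (k i))) →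
        (k i) + 1 ≤ (F.P Kt).m + (F.P Kt).K → 4 * (F.P Kt).L ≤ ν.M₁ → side (F.P Kt).L ν.M₁ (k i) ∣ (F.P Kt).sitesPerDir 0 → 0 ≤ ν.εreg →
        6 * ((((F.P Kt).d - 1 : ℕ)) : ℝ) * (F.P Kt).L * ν.εreg ≤ ρ5 i →
        ∀ (ext : GaugeField (F.P Kt) (k i) SU2 → GaugeField (F.P Kt) (k i) SU2) (Vk : GaugeField (F.P Kt) (k i) SU2),
        ∀ (U₀ : GaugeField (F.P Kt) 0 SU2) (Xf : GaugeSlice (pts (k i) Λ) T E3 → PBond (F.P Kt) 0 → lieSU (Fin 2)),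
        IsMinimizerB (Node00.avOfRecord F 2 Kt) (Node00.regMSCoPOfRecord F 2 ν Kt (k i) (maxDomT ν.M₁ Z)) (lamBondsSeq (maxDomT ν.M₁ Z) (k i))
          (avgFamily (Node00.avOfRecord F 2 Kt) (qsstarGIter0 (k i) (ext Vk))) U₀ →
        ∀ (S₀ : Set (PBond (F.P Kt) 0)), (∀ b ∉ S₀, b ∈ lamBondsSeq (maxDomT ν.M₁ Z) (k i) 0) → ∀ ⦃εP : ℝ⦄, 0 ≤ εP →
        (∀ p : Plaq (F.P Kt) 0, ((⟨p.src, p.μ⟩ : PBond (F.P Kt) 0) ∈ S₀ ∨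
            (⟨p.src.shift p.μ, p.ν⟩ : PBond (F.P Kt) 0) ∈ S₀ ∨
            (⟨p.src.shift p.ν, p.μ⟩ : PBond (F.P Kt) 0) ∈ S₀ ∨
            (⟨p.src, p.ν⟩ : PBond (F.P Kt) 0) ∈ S₀) →
          ‖((GaugeField.plaqHol U₀ p : SU2) : Matrix (Fin 2) (Fin 2) ℂ) - 1‖ ≤ εP) →
        ∀ (H : (Fin (constrCardB (lamBondsSeq (maxDomT ν.M₁ Z) (k i)) (k i)) → lieSU (Fin 2)) → PBond (F.P Kt) 0 → lieSU (Fin 2)),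
        (∀ v, fderiv ℝ (msChartB F 2 Kt (k i) (lamBondsSeq (maxDomT ν.M₁ Z) (k i)) (avgFamily (avOfRecord F 2 Kt) (qsstarGIter0 (k i) (ext Vk))) U₀) 0 (H v) = v) →
        ∀ ⦃B₁ : ℝ⦄, 0 ≤ B₁ →
        (∀ i' : Fin (constrCardB (lamBondsSeq (maxDomT ν.M₁ Z) (k i)) (k i)), 1 ≤ ((((constrEnumB (lamBondsSeq (maxDomT ν.M₁ Z) (k i)) (k i)).symm i').1 : ℕ)) → ∀ ξ : lieSU (Fin 2),
          ∃ x : PBond (F.P Kt) 0 → lieSU (Fin 2), fderiv ℝ (msChartB F 2 Kt (k i) (lamBondsSeq (maxDomT ν.M₁ Z) (k i)) (avgFamily (avOfRecord F 2 Kt) (qsstarGIter0 (k i) (ext Vk))) U₀) 0 x = Pi.single i' ξ ∧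
            ∑ b, ‖(x b : Matrix (Fin 2) (Fin 2) ℂ)‖ ≤ B₁ * ‖ξ‖) →
        ∀ ⦃M₂ : ℝ⦄, (∀ w, ∑ c, ‖fderiv ℝ (fderiv ℝ (msChartB F 2 Kt (k i) (lamBondsSeq (maxDomT ν.M₁ Z) (k i)) (avgFamily (avOfRecord F 2 Kt) (qsstarGIter0 (k i) (ext Vk))) U₀)) 0 w w c‖ ≤ M₂ * ∑ b, ‖w b‖ ^ 2) →
        Xf 0 = 0 → ContDiffAt ℝ 2 Xf 0 →
        (∀ᶠ Y in 𝓝 (0 : GaugeSlice (pts (k i) Λ) T E3),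
          IsMinimizerB (Node00.avOfRecord F 2 Kt) (Node00.regMSCoPOfRecord F 2 ν Kt (k i) (maxDomT ν.M₁ Z)) (lamBondsSeq (maxDomT ν.M₁ Z) (k i))
            (avgFamily (Node00.avOfRecord F 2 Kt) (qsstarGIter0 (k i) (expMul su2Chart (ιA (pts (k i) Λ) T Y) (ext Vk)))) (expChart U₀ (Xf Y))) →
        ∀ ⦃K₂ : ℝ⦄, (∀ X : GaugeSlice (pts (k i) Λ) T E3, Real.sqrt (∑ b, ‖fderiv ℝ Xf 0 X b‖ ^ 2) ≤ K₂ * ‖X‖) →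
        ∀ (W : Finset (Plaq (F.P Kt) 0)),
        (∀ q : Plaq (F.P Kt) 0, q.src ∈ ((box (fun κ => (F.P Kt).L ^ (k i) * ((hi κ - lo κ + 1).toNat + 3 + 1) - 1) (fun κ => ((F.P Kt).L : ℤ) ^ (k i) * (lo κ - 2))).image
            (fun z => (castSite z : Site (F.P Kt) 0))) → q ∈ W) →
        ∀ ⦃δW : ℝ⦄, 0 < δW → δW < ρ i → δW < ρτ i →
        (∀ (ν' : Fin (F.P Kt).d), ∀ z ∈ box (fun κ => (hi κ - lo κ + 1).toNat + 3) (fun κ => lo κ - 2), ∀ b₀ : PBond (F.P Kt) 0,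
          (b₀ ∈ feeds (k i) (⟨(castSite z : Site (F.P Kt) (k i)), ⟨0, h0⟩⟩ : PBond (F.P Kt) (k i)) ∨ b₀ ∈ feeds (k i) (⟨((castSite z : Site (F.P Kt) (k i))).shift ⟨0, h0⟩, ν'⟩ : PBond (F.P Kt) (k i))
          ∨ b₀ ∈ feeds (k i) (⟨((castSite z : Site (F.P Kt) (k i))).shift ν', ⟨0, h0⟩⟩ : PBond (F.P Kt) (k i)) ∨ b₀ ∈ feeds (k i) (⟨(castSite z : Site (F.P Kt) (k i)), ν'⟩ : PBond (F.P Kt) (k i))) →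
          ‖((U₀ b₀ : SU2) : Matrix (Fin 2) (Fin 2) ℂ) - 1‖ ≤ δW) →
        ∃ (Ψ₂ : (PBond (F.P Kt) 0 → lieSU (Fin 2)) →L[ℝ] (PBond (F.P Kt) 0 → lieSU (Fin 2)) →L[ℝ] (Fin (constrCardB (lamBondsSeq (maxDomT ν.M₁ Z) (k i)) (k i)) → lieSU (Fin 2)))
          (lam : (Fin (constrCardB (lamBondsSeq (maxDomT ν.M₁ Z) (k i)) (k i)) → lieSU (Fin 2)) →L[ℝ] ℝ)
          (p : Seminorm ℝ (PBond (F.P Kt) 0 → lieSU (Fin 2))),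
          HasFDerivAt (fun Y => fderiv ℝ (msChartB F 2 Kt (k i) (lamBondsSeq (maxDomT ν.M₁ Z) (k i)) (avgFamily (avOfRecord F 2 Kt) (qsstarGIter0 (k i) (ext Vk))) U₀) Y) Ψ₂ 0 ∧
          (∀ᶠ Y in 𝓝 (0 : PBond (F.P Kt) 0 → lieSU (Fin 2)), DifferentiableAt ℝ (msChartB F 2 Kt (k i) (lamBondsSeq (maxDomT ν.M₁ Z) (k i)) (avgFamily (avOfRecord F 2 Kt) (qsstarGIter0 (k i) (ext Vk))) U₀) Y) ∧
          fderiv ℝ (fun Y : PBond (F.P Kt) 0 → lieSU (Fin 2) => wilsonAction4 (expChart U₀ Y)) 0 = lam.comp (fderiv ℝ (msChartB F 2 Kt (k i) (lamBondsSeq (maxDomT ν.M₁ Z) (k i)) (avgFamily (avOfRecord F 2 Kt) (qsstarGIter0 (k i) (ext Vk))) U₀) 0) ∧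
          (∀ Y : PBond (F.P Kt) 0 → lieSU (Fin 2), ∑ b, ‖(Y b : Matrix (Fin 2) (Fin 2) ℂ)‖ ^ 2 ≤ p Y ^ 2) ∧
          ∀ X : GaugeSlice (pts (k i) Λ) T E3,
            lam (Ψ₂ (fderiv ℝ Xf 0 X) (fderiv ℝ Xf 0 X))
                ≤ (2 * (((F.P Kt).d : ℝ) - 1) * εP * B₁ * M₂) * p (fderiv ℝ Xf 0 X) ^ 2 ∧
            p (fderiv ℝ Xf 0 X) ≤ K₂ * ‖X‖ ∧
            (((F.P Kt).L : ℝ) ^ (F.P Kt).d) ^ (k i) / ((((F.P Kt).L : ℝ)) ^ 2 * ((F.P Kt).L : ℝ) ^ 2) ^ (k i) / 2 * (∑ z ∈ box (fun κ => (hi κ - lo κ + 1).toNat + 3) (fun κ => lo κ - 2), ∑ μ : Fin (F.P Kt).d, ∑ a : Fin 3, curl (fun b => ιA (pts (k i) Λ) T X (⟨castSite b.1, b.2⟩ : PBond (F.P Kt) (k i)) a) z ⟨0, h0⟩ μ ^ 2)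
                - (((F.P Kt).L : ℝ) ^ (F.P Kt).d) ^ (k i) / ((((F.P Kt).L : ℝ)) ^ 2 * ((F.P Kt).L : ℝ) ^ 2) ^ (k i) * (8 * (((F.P Kt).d : ℝ) + 1) * (2 * ((Kτ i) + 1) * δW) + 8 * ((F.P Kt).d : ℝ) * (((box (fun κ => (hi κ - lo κ + 1).toNat + 3) (fun κ => lo κ - 2)).image (fun z => (castSite z : Site (F.P Kt) (k i)))).card : ℝ) * ((C i) * δW * K₂) ^ 2) * ‖X‖ ^ 2
              ≤ ((Fintype.card (Fin 2) : ℝ)⁻¹ • ∑ p ∈ W, (innerSL ℝ (E := lieSU (Fin 2))).bilinearComp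
                (ContinuousLinearMap.proj (R := ℝ) (φ := fun _ : PBond (F.P Kt) 0 => lieSU (Fin 2)) (⟨p.src, p.μ⟩ : PBond (F.P Kt) 0) + ContinuousLinearMap.proj (R := ℝ) (φ := fun _ : PBond (F.P Kt) 0 => lieSU (Fin 2)) (⟨p.src.shift p.μ, p.ν⟩ : PBond (F.P Kt) 0)
                  - ContinuousLinearMap.proj (R := ℝ) (φ := fun _ : PBond (F.P Kt) 0 => lieSU (Fin 2)) (⟨p.src.shift p.ν, p.μ⟩ : PBond (F.P Kt) 0) - ContinuousLinearMap.proj (R := ℝ) (φ := fun _ : PBond (F.P Kt) 0 => lieSU (Fin 2)) (⟨p.src, p.ν⟩ : PBond (F.P Kt) 0) : (PBond (F.P Kt) 0 → lieSU (Fin 2)) →L[ℝ] lieSU (Fin 2))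
                (ContinuousLinearMap.proj (R := ℝ) (φ := fun _ : PBond (F.P Kt) 0 => lieSU (Fin 2)) (⟨p.src, p.μ⟩ : PBond (F.P Kt) 0) + ContinuousLinearMap.proj (R := ℝ) (φ := fun _ : PBond (F.P Kt) 0 => lieSU (Fin 2)) (⟨p.src.shift p.μ, p.ν⟩ : PBond (F.P Kt) 0)
                  - ContinuousLinearMap.proj (R := ℝ) (φ := fun _ : PBond (F.P Kt) 0 => lieSU (Fin 2)) (⟨p.src.shift p.ν, p.μ⟩ : PBond (F.P Kt) 0) - ContinuousLinearMap.proj (R := ℝ) (φ := fun _ : PBond (F.P Kt) 0 => lieSU (Fin 2)) (⟨p.src, p.ν⟩ : PBond (F.P Kt) 0) : (PBond (F.P Kt) 0 → lieSU (Fin 2)) →L[ℝ] lieSU (Fin 2))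
                : (PBond (F.P Kt) 0 → lieSU (Fin 2)) →L[ℝ] (PBond (F.P Kt) 0 → lieSU (Fin 2)) →L[ℝ] ℝ) (fderiv ℝ Xf 0 X) (fderiv ℝ Xf 0 X))
    -- the `hsb`-free letter's numeric premises displayed: radius row, the class threshold positive, and its floor against `ρ5` AT THE DATUM SCALE `2·B₃·(cE+1)·eR i` (lane ruling (B) «(8)-FLOOR»)
    -- [15]'s comparability rows DOUBLED (base budget `(cE+1)·eR` + the class-reading tolerance `ν″_i.εreg := 2·B₃·(cE+1)·eR i` below the class of record; `B₃ > 0`) and the near count row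
    {cE B₃ a₀ a₁' cA : ℝ} (hcE0 : 0 ≤ cE) (hcE : ∀ i, 12 * ((F.P Kt).d : ℝ) * ((n i : ℝ) + 2) ^ 2 ≤ cE) (hB₃ : 0 < B₃)
    (heRa : ∀ i, (cE + 1) * (2 * eR i) ≤ a₁' ∧ B₃ * ((cE + 1) * (2 * eR i)) ≤ ν.εreg) (ha₀ : ν.εreg ≤ a₀)
    (hcA : ∀ i, 1 / 2 * (B₃ * (cE + 1) * (F.P Kt).eta 1 ^ 2) ^ 2 * (Nat.card {q : Plaq (F.P Kt) 0 // q ∈ plaqsOf (maxDomT ν.M₁ (Z i) 1)} : ℝ) ≤ cA)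
    (hM4 : 4 * (F.P Kt).L ≤ ν.M₁) (hεreg : 0 < ν.εreg) (hερ : ∀ i, 6 * ((((F.P Kt).d - 1 : ℕ)) : ℝ) * (F.P Kt).L * (2 * B₃ * (cE + 1) * eR i) ≤ ρ5 i)
    -- THE (P4)′ PRODUCER's TWO CONSTANTS, THE (P5) CONSTANT AND THE NEAR-FLAT GUARD RADIUS PER INSTANCE, AS BINDERS (`εH`, `ρ6`, `M₂` per height; `B₁` per `(M₁, Z)` — never after `εreg`∕`ρn`),
    -- and THREE LETTERS displayed: `hHrow` = the inner ∀-body of dag-n12-w6's PRINT-DATUM hull-count socket `N12ChartBRestrictHullCount.exists_rightInverse_hrow_uniformB_lamBondsSeq` (✓p775374) at `(2, Kt, k i, ν.M₁, Z i; εH i, B₁ i)` —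
    -- NO `SmallBelow U₀`: its guarded PROXIES (per constrained bond, per inner site) are produced from the class below — concluding, in ρ6b's PER-ROW ℓ¹ CURRENCY, a right inverse `H`
    -- (surjectivity witness) AND the per-row ℓ¹ preimage letter at `B₁ i`; `hsbU` ∕ `hcurv` = the two conjuncts of dag-n12-w4's `Node00.exists_uniform_chartCurvature_sq_bound (k i)` at
    -- `(ρ6 i, M₂ i)` (near-flat fields are guarded; uniform sup-curvature bound at the near-flat core) — ρ7 turns them into the ℓ¹-curvature bound with the local count `Σ_{j≤k i}(2d)^j`
    (εH B₁ M₂ ρ6 : ι → ℝ) (hB1 : ∀ i, 0 ≤ B₁ i) (hM₂0 : ∀ i, 0 ≤ M₂ i)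
    (hHrow : ∀ i (Wd : MSField (F.P Kt) SU2) (U₀ : GaugeField (F.P Kt) 0 SU2),
      AgreeOn (Bj ν.M₁ (Z i) (k i)) (avgFamily (Node00.avOfRecord F 2 Kt) U₀) Wd →
      (∀ i' : Fin (constrCard (Bj ν.M₁ (Z i) (k i)) (k i)), ∃ U' : GaugeField (F.P Kt) 0 SU2,
        (∀ b ∈ feeds (((constrEnum (Bj ν.M₁ (Z i) (k i)) (k i)).symm i').1 : ℕ) ((constrEnum (Bj ν.M₁ (Z i) (k i)) (k i)).symm i').2.1, U' b = U₀ b) ∧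
          Node00.SmallBelow (Node00.avOfRecord F 2 Kt) (k i) U') →
      (∀ (j : ℕ), 1 ≤ j → j ≤ k i → ∀ y : Site (F.P Kt) j, embIter j y ∈ maxDomT ν.M₁ (Z i) j → ∃ U' : GaugeField (F.P Kt) 0 SU2,
        (∀ c : PBond (F.P Kt) j, (c.src = y ∨ c.tgt = y) → ∀ b₀ : PBond (F.P Kt) 0,
          (iterBlockOf j b₀.src = c.src ∨ iterBlockOf j b₀.src = c.tgt) → (iterBlockOf j b₀.tgt = c.src ∨ iterBlockOf j b₀.tgt = c.tgt) → U' b₀ = U₀ b₀) ∧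
        Node00.SmallBelow (Node00.avOfRecord F 2 Kt) (k i) U') →
      (∀ (j : ℕ), 1 ≤ j → j ≤ k i → ∀ y : Site (F.P Kt) j, embIter j y ∈ maxDomT ν.M₁ (Z i) j →
        PlaqSmallOn (boxPlaqs (fun κ => lift (F.P Kt) (embIter j y) κ - ((((F.P Kt).L ^ j : ℕ) : ℤ) + ((((F.P Kt).L ^ j - 1) / 2 : ℕ) : ℤ)))
          (fun κ => lift (F.P Kt) (embIter j y) κ + ((((F.P Kt).L ^ j : ℕ) : ℤ) + ((((F.P Kt).L ^ j - 1) / 2 : ℕ) : ℤ))) : Set (Plaq (F.P Kt) 0)) (εH i) U₀) →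
      ∃ H : (Fin (constrCardB (lamBondsSeq (maxDomT ν.M₁ (Z i)) (k i)) (k i)) → lieSU (Fin 2)) → PBond (F.P Kt) 0 → lieSU (Fin 2),
        (∀ v, fderiv ℝ (msChartB F 2 Kt (k i) (lamBondsSeq (maxDomT ν.M₁ (Z i)) (k i)) Wd U₀) 0 (H v) = v) ∧
        ∀ i' : Fin (constrCardB (lamBondsSeq (maxDomT ν.M₁ (Z i)) (k i)) (k i)), 1 ≤ ((((constrEnumB (lamBondsSeq (maxDomT ν.M₁ (Z i)) (k i)) (k i)).symm i').1 : ℕ)) → ∀ ξ : lieSU (Fin 2),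
          ∃ x : PBond (F.P Kt) 0 → lieSU (Fin 2), fderiv ℝ (msChartB F 2 Kt (k i) (lamBondsSeq (maxDomT ν.M₁ (Z i)) (k i)) Wd U₀) 0 x = Pi.single i' ξ ∧
            ∑ b, ‖(x b : Matrix (Fin 2) (Fin 2) ℂ)‖ ≤ B₁ i * ‖ξ‖)
    (hsbU : ∀ i (V : GaugeField (F.P Kt) 0 SU2), ‖coeField V - 1‖ ≤ ρ6 i → Node00.SmallBelow (Node00.avOfRecord F 2 Kt) (k i) V)
    (hcurv : ∀ i (𝔅 : BDetSet (F.P Kt)) (Wd : MSField (F.P Kt) SU2) (V : GaugeField (F.P Kt) 0 SU2),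
      ‖coeField V - 1‖ ≤ ρ6 i → AgreeOnB 𝔅 (avgFamily (Node00.avOfRecord F 2 Kt) V) Wd →
      ∀ w : PBond (F.P Kt) 0 → lieSU (Fin 2), ‖fderiv ℝ (fderiv ℝ (msChartB F 2 Kt (k i) 𝔅 Wd V)) 0 w w‖ ≤ M₂ i * ‖w‖ ^ 2)
    -- the near-flat radius's floor AT THE DATUM SCALE (volume-free; lane ruling (B))
    (hερ6 : ∀ i, 6 * ((((F.P Kt).d - 1 : ℕ)) : ℝ) * (F.P Kt).L * (2 * B₃ * (cE + 1) * eR i) ≤ ρ6 i)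
    -- THE TWO CLASS-CONVERSION LETTERS of the datum-scale road (pass-through; «INHABITED BY»: dag-n12-c g31's kit `B15Prop1MinimiserClassAtDatumScale`):
    -- (K-a) base datum, (K-b) slice-perturbed datum near `0` — class of record ⟹ class at `ν″_i := {ν with εreg := 2·B₃·(cE+1)·eR i}`
    (hKa : ∀ i (Vk : GaugeField (F.P Kt) (k i) SU2), PlaqSmallOn (plaqsInside (pts (k i) (Z i ∩ (Λ i)ᶜ))) (eR i) Vk →
      (∀ b ∈ (boxBonds (LO i) (HI i) : Set (PBond (F.P Kt) (k i))), dist1 (ext i Vk b) ≤ ρn i) →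
      ∀ U₀ : GaugeField (F.P Kt) 0 SU2,
        IsMinimizerB (Node00.avOfRecord F 2 Kt) (Node00.regMSCoPOfRecord F 2 ν Kt (k i) (maxDomT ν.M₁ (Z i))) (lamBondsSeq (maxDomT ν.M₁ (Z i)) (k i))
          (avgFamily (Node00.avOfRecord F 2 Kt) (qsstarGIter0 (k i) (ext i Vk))) U₀ →
        IsMinimizerB (Node00.avOfRecord F 2 Kt) (Node00.regMSCoPOfRecord F 2 {ν with εreg := 2 * B₃ * (cE + 1) * eR i} Kt (k i) (maxDomT ν.M₁ (Z i))) (lamBondsSeq (maxDomT ν.M₁ (Z i)) (k i))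
          (avgFamily (Node00.avOfRecord F 2 Kt) (qsstarGIter0 (k i) (ext i Vk))) U₀)
    (hKb : ∀ i (Vk : GaugeField (F.P Kt) (k i) SU2), PlaqSmallOn (plaqsInside (pts (k i) (Z i ∩ (Λ i)ᶜ))) (eR i) Vk →
      (∀ b ∈ (boxBonds (LO i) (HI i) : Set (PBond (F.P Kt) (k i))), dist1 (ext i Vk b) ≤ ρn i) →
      ∃ r : ℝ, 0 < r ∧ ∀ Y : GaugeSlice (pts (k i) (Λ i)) (T i) E3, ‖Y‖ < r → ∀ U : GaugeField (F.P Kt) 0 SU2,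
        IsMinimizerB (Node00.avOfRecord F 2 Kt) (Node00.regMSCoPOfRecord F 2 ν Kt (k i) (maxDomT ν.M₁ (Z i))) (lamBondsSeq (maxDomT ν.M₁ (Z i)) (k i))
          (avgFamily (Node00.avOfRecord F 2 Kt) (qsstarGIter0 (k i) (expMul su2Chart (ιA (pts (k i) (Λ i)) (T i) Y) (ext i Vk)))) U →
        IsMinimizerB (Node00.avOfRecord F 2 Kt) (Node00.regMSCoPOfRecord F 2 {ν with εreg := 2 * B₃ * (cE + 1) * eR i} Kt (k i) (maxDomT ν.M₁ (Z i))) (lamBondsSeq (maxDomT ν.M₁ (Z i)) (k i))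
          (avgFamily (Node00.avOfRecord F 2 Kt) (qsstarGIter0 (k i) (expMul su2Chart (ιA (pts (k i) (Λ i)) (T i) Y) (ext i Vk)))) U)
    -- NO letter per guarded base field ∕ minimiser remains here: the (P4)′ socket and the (P5) row are DISCHARGED below from the class through `hHrow` ∕ `hsbU` ∕ `hcurv` (+ ρ7's local count)
    -- numerics: the positivity constant fits (`γ₀ := 1∕2`: the chart half's level factor `((L^d)^k∕(L²·L²)^k)∕2` at `d = 4`)
    (hγle : ∀ i, γ / (M i) ^ 5 ≤ 1 / 2 / (2 * (3 * (K i : ℝ) ^ 2 + 2 * (K i : ℝ) ^ 4)))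
    (hfar : ∀ i (b : PBond (F.P Kt) 0), b.src ∉ maxDomT ν.M₁ (Z i) 1 →
      (⟨blockIter (k i) b.src, b.dir⟩ : PBond (F.P Kt) (k i)) ∉ bondsOf (pts (k i) (Λ i)))
    (hZblk : ∀ i, IsBlockUnion (k i) (Z i))
    (hM2 : 2 ≤ ν.M₁) (hdiv : ∀ i, side (F.P Kt).L ν.M₁ (k i) ∣ (F.P Kt).sitesPerDir 0)
    (h15T : ∀ (i : ι) (s : B14.Eq218Concrete.Seq (fun n : ℕ => Node00.unionsOfCubes (F.P Kt) (side (F.P Kt).L ν.M₁ n)) (k i)),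
      Node00.Sect2.SeqSeparated ν.M₁ s → 0 < ν.M₁ →
      ∀ (ε₀ : ℝ) (δ : ℕ → ℝ), (∀ j, j ≤ k i → 0 < δ j ∧ δ j ≤ a₁' ∧ B₃ * δ j ≤ ε₀) → (∀ j, j < k i → δ j ≤ 2 * δ (j + 1)) →
      (∀ j, j < k i → δ (j + 1) ≤ 2 * δ j) → ε₀ ≤ a₀ →
      ∀ W : MSField (F.P Kt) SU2,
        Node00.Sect2.DataSmall7PTop (Node00.avOfRecord F 2 Kt) s.Ω (Node00.suppDomOfRecord F ν Kt s.Ω) (k i) δ W →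
        ∀ U₀ : GaugeField (F.P Kt) 0 SU2, IsMinimizerB (Node00.avOfRecord F 2 Kt)
            {U | (∀ j, j ≤ k i → PlaqSmallOn (Node00.Sect2.omegaPlaqsTop s.Ω (Node00.suppDomOfRecord F ν Kt s.Ω) j)
                (ε₀ * (F.P Kt).eta j ^ 2) U) ∧
              Node00.Sect2.CoDivClassOnTop s.Ω (Node00.suppDomOfRecord F ν Kt s.Ω) (k i) ε₀ U}
            (lamBondsSeq s.Ω (k i)) W U₀ →
          (∀ j, j ≤ k i → PlaqSmallOn (Node00.Sect2.omegaPlaqsTop s.Ω (Node00.suppDomOfRecord F ν Kt s.Ω) j)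
              (B₃ * δ j * (F.P Kt).eta j ^ 2) U₀) ∧
            ∀ j, j ≤ k i → Node00.Sect2.CoDivSmallOn (Node00.Sect2.omegaBondsTop s.Ω (Node00.suppDomOfRecord F ν Kt s.Ω) j)
              (B₃ * δ j * (F.P Kt).eta j ^ 3) U₀)
    (hcJ' : ∀ i, 2 * cA * eR i / R i + 2 * ((Nat.card {q : Plaq (F.P Kt) 0 // q ∈ plaqsOf (maxDomT ν.M₁ (Z i) 1)} : ℝ) * (1 + 8 * 𝓐₀ i ^ 4)) / (R i * eR i) ≤ cJ)
    -- THE EXPLICIT-THRESHOLD FRAME (no `∃ δ₀`): tolerances below `Θ i := min (min (ρ i) (ρτ i) ∕ 2) (min 1 (rhs_i ∕ (max S_i 0 + 1)))`, every symbol a binder or a cardinality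
    : ∀ δ : ι → ℝ, (∀ i, 0 < δ i) →
      (∀ i, δ i ≤ min (min (min (ρ i) (ρτ i) / 2)
        (min 1 (1 / 2 / (2 * (3 * (K i : ℝ) ^ 2 + 2 * (K i : ℝ) ^ 4)) /
          (max ((32 * (((F.P Kt).d : ℝ) - 1) + 8 * (((F.P Kt).d : ℝ) - 1) + (2 * (((F.P Kt).d : ℝ) - 1) * B₁ i * (((∑ j ∈ Finset.range (k i + 1), (2 * (F.P Kt).d) ^ j : ℕ) : ℝ) * M₂ i))) * (12 * 𝓐₀ i / R i * Real.sqrt (Nat.card {b : PBond (F.P Kt) 0 // b ∈ {b : PBond (F.P Kt) 0 | b.src ∈ maxDomT ν.M₁ (Z i) 1 ∨ b.tgt ∈ maxDomT ν.M₁ (Z i) 1}})) ^ 2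
            + (8 * (((F.P Kt).d : ℝ) + 1) * (2 * (Kτ i + 1)) + 8 * ((F.P Kt).d : ℝ) * (((box (fun κ => (hi i κ - lo i κ + 1).toNat + 3) (fun κ => lo i κ - 2)).image (fun z => (castSite z : Site (F.P Kt) (k i)))).card : ℝ) * (C i * (12 * 𝓐₀ i / R i * Real.sqrt (Nat.card {b : PBond (F.P Kt) 0 // b ∈ {b : PBond (F.P Kt) 0 | b.src ∈ maxDomT ν.M₁ (Z i) 1 ∨ b.tgt ∈ maxDomT ν.M₁ (Z i) 1}}))) ^ 2)) 0 + 1)))) (εH i)) →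
      -- (σ)_W, THE PLAQUETTE LETTER AND THE TOWER-BOX PLAQUETTE LETTER ALL DISCHARGED FROM THE CLASS (dag-n12-w6 g7's k-UNIFORM window-LOCAL producer `hσW_on_uniform_of_class_lamBondsSeq`,
      -- dag-n12-c g21's `hPχ_on_of_class` ∕ `hPbox_on_of_class`, at tolerance `δ i`, `ε := εreg`): the ONLY row left under the threshold is the producer's k-FREE TOLERANCE FLOOR —
      -- `(((4d+m′+3)²L²∕4) + m′·24(((d+2)L)²∕4))·εreg + m′·ρn i ≤ δ i` (with `δ i` below the EXPLICIT threshold above: a checkable smallness condition on the class threshold `εreg` and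
      -- the datum tolerance `ρn i`, uniform in the height `k` — the direct road's displayed price)
      ∀ (hfloor : ∀ i, ((((4 * (F.P Kt).d + (3 * ((F.P Kt).d * (((F.P Kt).L - 1) / 2)) + 5) + 3 : ℕ) : ℝ)) ^ 2 * ((F.P Kt).L : ℝ) ^ 2 / 4 + ((3 * ((F.P Kt).d * (((F.P Kt).L - 1) / 2)) + 5 : ℕ) : ℝ) * (24 * (((((F.P Kt).d + 2) * (F.P Kt).L : ℕ) : ℝ) ^ 2 / 4))) * (2 * B₃ * (cE + 1) * eR i) + ((3 * ((F.P Kt).d * (((F.P Kt).L - 1) / 2)) + 5 : ℕ) : ℝ) * ρn i ≤ δ i),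
      ∃ a₁ : ι → ℝ, (∀ i, 0 < a₁ i) ∧
      B15.Prop1Printed (lfVarOn su2Chart fun i =>
        InstOn.stdB (Node00.bgMSCoPOfRecordB F 2 ν Kt (k i) (maxDomT ν.M₁ (Z i))) ν.M₁ lamDatumP (Z i) (Λ i) (k i) (M i) (a₁ i)
          (anExt (pts (k i) (Λ i)) (T i)
            (fun177stdB (Node00.bgMSCoPOfRecordB F 2 ν Kt (k i) (maxDomT ν.M₁ (Z i))) ν.M₁ lamDatumP (Z i) (k i)) (ext i)
            (min (1 / 2) (min (R i / 8) (γ / (M i) ^ 5 * (R i / 2) ^ 2 /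
              (48 * (4 * ((Nat.card {q : Plaq (F.P Kt) 0 // q ∈ plaqsOf (maxDomT ν.M₁ (Z i) 1)} : ℝ) * (1 + 8 * 𝓐₀ i ^ 4)) / R i + 1))))))) := by
  have hk : ∀ i, k i ≤ (F.P Kt).m + (F.P Kt).K := fun i => Nat.le_of_succ_le (hk1 i)
  have hρn0 : ∀ i, 0 ≤ ρn i := fun i => le_trans (by have := heR i; positivity) (hρn i)
  have hrad : (F.P Kt).L + ((F.P Kt).L - 1) / 2 ≤ ν.M₁ := by have := hM4; omega
  -- the datum-scale tolerance `e i := 2·B₃·(cE+1)·eR i`: positive and below the class threshold (doubled comparability row)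
  have hc1 : 0 < cE + 1 := by linarith
  have hεpos'' : ∀ i, (0 : ℝ) < 2 * B₃ * (cE + 1) * eR i := fun i => by have := heR i; positivity
  have hεle'' : ∀ i, 2 * B₃ * (cE + 1) * eR i ≤ ν.εreg := fun i => by
    have h := (heRa i).2; have e : B₃ * ((cE + 1) * (2 * eR i)) = 2 * B₃ * (cE + 1) * eR i := by ring
    linarith [e ▸ h]
  have hL2 : (0 : ℝ) ≤ ((F.P Kt).L : ℝ) ^ 2 := by positivity
  have hα3'' : ∀ i, (143 * (((((F.P Kt).d + 4 : ℕ) : ℝ)) ^ 2 / 4) ^ 2) * ((2 * B₃ * (cE + 1) * eR i) * (F.P Kt).L ^ 2) ≤ 1 / 3 := fun i =>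
    le_trans (mul_le_mul_of_nonneg_left (mul_le_mul_of_nonneg_right (hεle'' i) hL2) (by positivity)) hα3
  have hα2'' : ∀ i, 2 * ((2 * B₃ * (cE + 1) * eR i) * (F.P Kt).L ^ 2) ≤ 2 * deltaSU (Fin 2) / ((((F.P Kt).d + 4) * (F.P Kt).L : ℕ) : ℝ) ^ 2 := fun i =>
    le_trans (by linarith [mul_le_mul_of_nonneg_right (hεle'' i) hL2]) hα2
  have haN'' : ∀ i, (((((F.P Kt).d + 2) * (F.P Kt).L : ℕ) : ℝ) ^ 2 / 4) * (2 * ((2 * B₃ * (cE + 1) * eR i) * (F.P Kt).L ^ 2)) < deltaSU (Fin 2) := fun i =>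
    lt_of_le_of_lt (mul_le_mul_of_nonneg_left (by linarith [mul_le_mul_of_nonneg_right (hεle'' i) hL2]) (by positivity)) haN
  intro δ hδpos hδle hfloor
  -- the class letters' tolerance condition `e i ≤ δ i` from the floor (its coefficient is `≥ 1`)
  have hδε : ∀ i, 2 * B₃ * (cE + 1) * eR i ≤ δ i := fun i => by
    have hm : (0 : ℝ) ≤ ((3 * ((F.P Kt).d * (((F.P Kt).L - 1) / 2)) + 5 : ℕ) : ℝ) * ρn i := mul_nonneg (Nat.cast_nonneg _) (hρn0 i)
    have h8 : (8 : ℝ) ≤ (((4 * (F.P Kt).d + (3 * ((F.P Kt).d * (((F.P Kt).L - 1) / 2)) + 5) + 3 : ℕ) : ℝ)) := by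
      have h : 8 ≤ 4 * (F.P Kt).d + (3 * ((F.P Kt).d * (((F.P Kt).L - 1) / 2)) + 5) + 3 := by omega
      exact_mod_cast h
    have hL1 : (1 : ℝ) ≤ ((F.P Kt).L : ℝ) := by exact_mod_cast Nat.succ_le_of_lt (F.P Kt).L_pos
    have hB : (0 : ℝ) ≤ ((3 * ((F.P Kt).d * (((F.P Kt).L - 1) / 2)) + 5 : ℕ) : ℝ) * (24 * (((((F.P Kt).d + 2) * (F.P Kt).L : ℕ) : ℝ) ^ 2 / 4)) := by positivity
    have hAL : (8 : ℝ) * 1 ≤ (((4 * (F.P Kt).d + (3 * ((F.P Kt).d * (((F.P Kt).L - 1) / 2)) + 5) + 3 : ℕ) : ℝ)) * ((F.P Kt).L : ℝ) := mul_le_mul h8 hL1 zero_le_one (by positivity)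
    have h64 : (8 : ℝ) * 1 * (8 * 1) ≤ (((4 * (F.P Kt).d + (3 * ((F.P Kt).d * (((F.P Kt).L - 1) / 2)) + 5) + 3 : ℕ) : ℝ)) * ((F.P Kt).L : ℝ) * ((((4 * (F.P Kt).d + (3 * ((F.P Kt).d * (((F.P Kt).L - 1) / 2)) + 5) + 3 : ℕ) : ℝ)) * ((F.P Kt).L : ℝ)) :=
      mul_le_mul hAL hAL (by norm_num) (by positivity)
    have hC : (1 : ℝ) ≤ (((4 * (F.P Kt).d + (3 * ((F.P Kt).d * (((F.P Kt).L - 1) / 2)) + 5) + 3 : ℕ) : ℝ)) ^ 2 * ((F.P Kt).L : ℝ) ^ 2 / 4 + ((3 * ((F.P Kt).d * (((F.P Kt).L - 1) / 2)) + 5 : ℕ) : ℝ) * (24 * (((((F.P Kt).d + 2) * (F.P Kt).L : ℕ) : ℝ) ^ 2 / 4)) := by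
      nlinarith [h64, hB]
    have h1 := le_mul_of_one_le_left (hεpos'' i).le hC
    linarith [hfloor i, hm, h1]
  -- (D1)⁶ with the three letters fed by their class producers AT THE DATUM SCALE `ν″_i` (per instance), tolerance `δc = δW := δ i`
  exact exists_domain_prop1Printed_lfVarOn_std_su2_box_intrinsic_analytic_atZSeqCoPRecord_ofThm1AtLength_ofMinimiserFamily_ofWindowGaugeLetter_ofClassOnlyRowL1NearRadiusDatumScale_explicit
    ν Kt hd3 h0 Z Λ k M hk0 hk1 eR heR T lo hi n hn hN hbox hZ hTG0 hN5 K hK1 hKn ext hext hlohi LO HI hLO hHI n' hn' hn'N hR' ρn hρn hγ hcJ hbx hbxM hM hR h𝓐₀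
    hMin hΩw W hWbox C ρ Kτ ρτ ρ5 hρ hKτ hρτ hhalf hcE0 hcE hB₃.le heRa ha₀ hcA hM4 hεreg hερ εH B₁ M₂ ρ6 hB1 hM₂0 hHrow hsbU hcurv hερ6 hKa hKb hγle hfar hZblk hM2 hdiv h15T
    hcJ'
    δ hδpos hδle
    (fun i Vk _ hnV U₀ hmin0 => hσW_uniform_of_plaqSmall_lamBondsSeq {ν with εreg := 2 * B₃ * (cE + 1) * eR i} Kt h0 (hk0 i) (hk i) (hdiv i) (Z i) (hkc i) (hc i) (hρn0 i) (ext i Vk)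
      (boxBonds (LO i) (HI i)) hnV hmin0 (hεpos'' i)
      (((Node00.mem_regMSCoPOfRecord_iff F 2 {ν with εreg := 2 * B₃ * (cE + 1) * eR i} Kt (k i) (maxDomT ν.M₁ (Z i)) U₀).1 hmin0.1).1 (k i - 1) (Nat.sub_le _ _))
      (hα3'' i) (hα2'' i) (haN'' i) (X i) (hXΩ i) (hfit i) (hBox i) (lo i) (hi i) (W i) (hWX i) (hfeedsX i) (hfloor i) (hfloor i))
    (fun i _ _ _ _ hmin p hp => norm_plaqHol_sub_one_le_of_isMinimizer_of_cornerBond_touching {ν with εreg := 2 * B₃ * (cE + 1) * eR i} Kt (hk0 i) (Z i) hmin (hεpos'' i).le (hδε i) p hp)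
    (fun i _ _ _ _ hmin _ hj1 hjk y hy => plaqSmallOn_towerBox_of_isMinimizer {ν with εreg := 2 * B₃ * (cE + 1) * eR i} Kt (Z i) hmin hM2 hrad (hdiv i) (hεpos'' i).le (hδε i) hj1 hjk y hy)

end

end Summit.QuantumFields.YangMills.BalabanUVNodes.N12Prop1DirectOfClassOnlyRowL1NearRadiusDatumScaleAtLengthWindowUniformB

end
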